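import Literature.LinearAlgebra.TensorNetworks.QTTCirculantRankBounds
import Literature.LinearAlgebra.Matrix.CirculantDFT

/-!
# Inverses of band circulant matrices and their QTT ranks
(Vysotsky–Rakhuba 2022, §2: Lemma 2.1, Theorem 2.1 (structure), Proposition 2.1; Corollary 3.3)

Source: L. Vysotsky, M. Rakhuba, *Tensor rank bounds and explicit QTT representations for the
inverses of circulant matrices*, Numer. Linear Algebra Appl. 30(3) (2023) e2461, arXiv:2205.04335
[VysotskyRakhuba2022] (held text: `paper:arxiv-2205.04335`, §2 and §3).  Builds on the §3 file
`QTTCirculantRankBounds` (Theorem 3.1 / Corollary 3.1: `rank_qttUnfolding_circulant_le`,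
`exists_qttMatrix_eq_circulant_rank_le`), whose header lists Corollary 3.3 as not formalised, and
on `LinearAlgebra/Matrix/CirculantDFT` (`det circ(v) = ∏_s λ_s`) for Proposition 2.1.

## The statements (verbatim, arXiv text)

§2, eq. (2): `A = circ(a₀, a₁, …, a_{m-1}, 0, …, 0, a_{-n}, …, a_{-1}) ∈ ℂ^{N×N}` — the band
circulant with first column `(a₀, a₁, …, a_{m-1}, 0, …, 0, a_{-n}, …, a_{-1})ᵀ`, "with the
additional assumption that `m ≥ 1, n ≥ 0, a_{m-1} ≠ 0, a_{-n} ≠ 0`."  "It is well-known that the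
inverse of a circulant matrix is also a circulant.  For `j = 0, …, N-1`, let `b_j` be the `j`-th
element of the first column of `B = A⁻¹`": the system `∑_j A_{k,j} B_{j,ℓ} = δ_{k,ℓ}` is (3)
`∑_{j=0}^{N-1} A_{(k-j) mod N, 0} b_{(j-ℓ) mod N} = δ_{k,ℓ}`.  With the biinfinite Toeplitz matrix
`A^{(∞)}_{i,j} = a_{i-j}` if `-n ≤ i-j ≤ m-1`, `0` otherwise, and (4) `A^{(∞)} ξ = β`,
`ξ_j = b_{j mod N}`, `β_j = 1` if `j mod N = 0`, `0` otherwise: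

"**Lemma 2.1.** Equations (3) and (4), considered as equations for `b₀, …, b_{N-1}` are
equivalent."

(5) `f(z) ≡ a_{-n} z^{-n} + ⋯ + a_{-1} z^{-1} + a₀ + a₁ z + ⋯ + a_{m-1} z^{m-1}`.

"**Theorem 2.1.** Let `m` and `n` be nonnegative integers such that `m ≥ 2` and `A ∈ ℂ^{N×N}` be
the circulant matrix of the form (2).  Denote by `g(z)` and `h(z)` the polynomials
`g(z) ≡ ∑_{k=-n}^{m-1} a_k z^{k+n}`, `h(z) ≡ ∑_{k=-n}^{m-1} a_k z^{m-k-1}`.  Assume that `g(z)` does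
not have roots on the unit circle `U`. […]  Under these conditions `A` is invertible and its
inverse is the circulant matrix `B ∈ ℂ^{N×N}` with the elements `B_{j,ℓ} = b_{(j-ℓ) mod N}`:
`b_j = ∑_{k=1}^s ∑_{p'} c_{g,k,p'} (-j+n-1+N)^{p'} z_k^{-j+n-1+N-p'}
      + ∑_{k=1}^t ∑_{q'} c_{h,k,q'} (j+m-2)^{q'} w_k^{j+m-2-q'}` (7) […]" (`z_k` the roots of `g`,
`w_k` those of `h`, inside `U`, with multiplicities `p_k`, `q_k`; explicit residue constants `c`).

"**Proposition 2.1.** The circulant `A ∈ ℂ^{N×N}` is invertible if and only if the corresponding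
polynomial `g(z)` does not have roots of the form `e^{-2πi s/N}`, `s ∈ {0, …, N-1}`."  (Proof:
"the eigenvalues `λ_s` of `A` are the elements of column `F_N A_{:,0}` […]
`λ_s = ∑_{t=0}^{N-1} e^{-2πi st/N} A_{t,0} = f(e^{-2πi s/N})`.")

"**Corollary 3.3.** Fix an arbitrary positive integer `L` and let `A ∈ ℂ^{b^L × b^L}` be a
circulant satisfying the conditions of Theorem 2.1.  Then the QTT ranks of `A⁻¹` do not exceed
`m + n`."  (Proof: `(A⁻¹)_{ij} = f((i-j) mod b^L)` with `f(i) = ∑_k P_k(i) z_k^{-i} + ∑_k Q_k(i) w_k^i`,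
Corollary 3.2, and "the sum of multiplicities of roots of a polynomial of degree `m+n-1` equals
`m+n-1`", so the ranks do not exceed `1 + (m+n-1) = m+n`.)

## What is proved here, and how (any field `K` unless stated; the paper has `K = ℂ`)

* The objects (`namespace … TensorNetworks.BandCirculant`): the band circulant `bandCirc N m n a`
  (`A_{xy} = ∑_{k=-n}^{m-1} [x-y ≡ k (mod N)] a_k`, band coefficients read from `a : ℤ → K` on
  `[-n, m-1]`; `= Matrix.circulant (bandCol N m n a)`, `bandCirc_eq_circulant`, and for
  `m + n ≤ N` the first column is literally `(a₀, …, a_{m-1}, 0, …, 0, a_{-n}, …, a_{-1})`,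
  `bandCol_apply_of_le`); the periodic reading of indices `pmod N z ∈ Fin N`; the two-sided
  solution space `recSol c ⊆ (ℤ → K)` of a recurrence `∑_{r=0}^{D} c_r u_{i+r} = 0` (`i ∈ ℤ`) — the
  kernel of the biinfinite band Toeplitz operator — with the band's coefficients
  `bandCoeff m n a r = a_{m-1-r}` (`D = m+n-1`); the symbol `f` (`symbol`, a Laurent polynomial
  evaluated with integer powers) and the polynomials `g` (`gPoly`), `h` (`hPoly`) of Theorem 2.1,
  with `g(z) = z^n f(z)`, `h(z) = z^{m-1} f(1/z)` (`eval_gPoly`, `eval_hPoly`) and `h = ∑_r c_r z^r`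
  the characteristic polynomial of the band recurrence (`hPoly_eq_sum_bandCoeff`).
* LEMMA 2.1 (`bandCirc_mulVec_eq_single_iff`; general right-hand side `bandCirc_mulVec_eq_iff`):
  `A v = e₁ ⇔ ∑_{k=-n}^{m-1} a_k v_{(i-k) mod N} = [N ∣ i]` for all `i ∈ ℤ`, from the stencil
  formula `(A v)_x = ∑_k a_k v_{(x-k) mod N}` (`bandCirc_mulVec`).  "The inverse of a circulant is a
  circulant": `A ξ = e₁ ⇒ A⁻¹ = circ(ξ)` (`inv_bandCirc_eq_circulant`, via Mathlib's
  `circulant_mul`), and `ξ_j = (A⁻¹)_{j,0}` solves `A ξ = e₁` (`bandCirc_mulVec_invCol`).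
* The two-sided recurrence (standard linear algebra, tagged to the proofs of Theorem 2.1 /
  Corollary 3.3 it serves — the paper's "`m+n-1`" exponential–polynomial terms and the count
  `1 + (m+n-1)`): for `c₀ ≠ 0 ≠ c_D` the restriction of `recSol c` to any window of `D`
  consecutive indices is a linear bijection (`windowMap_injective`, `windowMap_surjective`; existence
  by gluing the forward solution of Mathlib's `LinearRecurrence.mkSol` with the forward solution of
  the reversed recurrence), so `dim recSol c = D` (`finrank_recSol`), and `recSol c` is shift
  invariant (`shift_mem_recSol`).
* THEOREM 2.1, STRUCTURAL FORM (`exists_recSol_eq_of_mulVec_eq_single`,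
  `exists_recSol_inv_bandCirc_eq_circulant`): for ANY field, any INVERTIBLE band circulant with
  `m ≥ 2`, `a_{m-1} ≠ 0 ≠ a_{-n}`: `A⁻¹ = circ(E|_{[0,N)})` for a two-sided solution `E ∈ recSol`
  of the homogeneous band system `∑_k a_k E_{i-k} = 0` (`mem_recSol_bandCoeff_iff`).  Proof (ours,
  residue-free): by Lemma 2.1 the periodic extension `V_i = ξ_{i mod N}` satisfies the band
  relation at every stencil based at `i ∉ Nℤ`; the stencils ending at `j ∈ [m+n-1, N)` are based
  at `i = j - n ∈ [m-1, N-1-n] ⊆ (0, N)` BECAUSE `m ≥ 2` (this is where the paper's `m ≥ 2`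
  enters; for `m = 1` the stencil ending at `j = n` is based at `0`), so `V` and the two-sided
  solution `E` with the same initial window `[0, m+n-1)` agree on `[0, N)` by induction along the
  stencils (`a_{-n} ≠ 0`).  The geometric members of `recSol` are exactly the `w^i` with
  `h(w) = 0`, i.e. `f(1/w) = 0` (`zpow_mem_recSol_bandCoeff_iff`, `…_iff_symbol`) — the
  exponentials `w_k^j`, `z_k^{-j}` of formula (7).
* PROPOSITION 2.1 over `ℂ` (`isUnit_det_bandCirc_iff_gPoly`, symbol form
  `isUnit_det_bandCirc_iff_symbol`): `A` is invertible iff `g(e^{-2πi s/N}) ≠ 0` for all `s`, via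
  `λ_s = f(ζ_s⁻¹)` (`circulantEig_bandCol`, `ζ_s = e^{2πi s/N} = cycleRoot N s`) and
  `det A = ∏_s λ_s` (`det_circulant_eq_prod_circulantEig`).
* COROLLARY 3.3 (`rank_qttUnfolding_inv_bandCirc_le`; over `ℝ` the representation form
  `exists_qttMatrix_eq_inv_bandCirc`): for an invertible `b^L × b^L` band circulant with `m ≥ 2`,
  `a_{m-1} ≠ 0 ≠ a_{-n}`, every QTT unfolding matrix of `A⁻¹` has rank `≤ m + n`, and over `ℝ`
  `A⁻¹` admits a QTT representation with ranks `≤ m + n` — exactly the paper's route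
  (`A⁻¹ = circ(E)`, the shifts of `E` stay in `recSol`, `dim recSol ≤ m+n-1`, Corollary 3.1), with
  the dimension count replacing the root bookkeeping of the printed proof.

GENERALITY.  The hypotheses here are `A` invertible, `m ≥ 2`, `a_{m-1} ≠ 0 ≠ a_{-n}` over any
field (Corollary 3.3's representation half over `ℝ`); the paper's hypothesis "`g` has no roots on
`U`" implies invertibility (Theorem 2.1), so the printed Corollary 3.3 is the special case `K = ℂ`,
and the formal statement also covers invertible band circulants whose symbol vanishes on `U`
(the paper's Example 2.1, `circ(1,1,0)`, `f(z) = 1 + z`).  For `N < m + n` the bands of (2) overlap;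
`bandCirc` then sums the wrapped bands (the periodised stencil, which is what Lemma 2.1 describes),
and all statements hold verbatim.

Not formalised here: the contour-integral matrix `B^{(∞)}` (6), Lemma 2.2 (`A^{(∞)} B^{(∞)} = I`)
and the explicit residue constants `c_{g,k,p'}`, `c_{h,k,q'}` of formula (7) / Corollary 2.1
(partial fractions of `1/g`, `1/h`); only the STRUCTURE of (7) — `b` is the restriction of a
two-sided solution of the band recurrence, a space of dimension `m+n-1` containing the exponentials
of the roots — is proved, which is all Corollary 3.3 uses.  The case `m = 1` (lower-triangular
band plus wrap) is outside Theorem 2.1 and not treated.  §4 (explicit QTT representation of the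
inverse, Lemma 4.1 / Theorem 4.1) is not here.

AI-produced formalisation (H21 engines group, seat eng-quad-2, 2026-08-23); statements checked
against the arXiv text; no facts, no axioms beyond Mathlib's, no `sorry`.
-/

open Matrix Finset

universe u

namespace Literature.LinearAlgebra.TensorNetworks.BandCirculant

/-! ## A. Two-sided linear recurrences on `ℤ` -/

section TwoSided

variable {K : Type u} [Field K] {D : ℕ}

/-- [cite: VysotskyRakhuba2022, §2 (bi-infinite Toeplitz system (4))]
The space of two-sided solutions `u : ℤ → K` of the constant-coefficient recurrence
`∑_{r=0}^{D} c r * u (i + r) = 0` for all `i : ℤ` (a bi-infinite band Toeplitz operator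
applied to `u` vanishes). -/
def recSol (c : Fin (D + 1) → K) : Submodule K (ℤ → K) where
  carrier := {u | ∀ i : ℤ, ∑ r : Fin (D + 1), c r * u (i + r) = 0}
  zero_mem' := fun i => by simp
  add_mem' := by
    intro u v hu hv i
    simp only [Pi.add_apply, mul_add, Finset.sum_add_distrib, hu i, hv i, add_zero]
  smul_mem' := by
    intro t u hu i
    simp only [Pi.smul_apply, smul_eq_mul, mul_left_comm _ t, ← Finset.mul_sum, hu i, mul_zero]

/-- [cite: VysotskyRakhuba2022, §2 eq. (4)]
Membership in `recSol c`, unfolded: `u` solves the homogeneous bi-infinite band system. -/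
theorem mem_recSol_iff (c : Fin (D + 1) → K) (u : ℤ → K) :
    u ∈ recSol c ↔ ∀ i : ℤ, ∑ r : Fin (D + 1), c r * u (i + r) = 0 := Iff.rfl

/-- [cite: VysotskyRakhuba2022, Cor. 3.3 (proof)]
The solution space of a two-sided constant-coefficient recurrence is shift invariant — so it can
serve as the space `V ⊇ {f_q}` of Theorem 3.1 for any member `f` (the step "the shifts are again
of this form" of the proofs of Corollaries 3.2/3.3; standard). -/
theorem shift_mem_recSol {c : Fin (D + 1) → K} {u : ℤ → K} (hu : u ∈ recSol c) (q : ℤ) :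
    (fun i => u (i + q)) ∈ recSol c := by
  intro i
  have h := hu (i + q)
  simpa only [add_right_comm _ q] using h

/-- [cite: VysotskyRakhuba2022, Thm. 2.1 (proof)]
A two-sided solution whose leading and trailing coefficients are nonzero and which vanishes on a
window of `D` consecutive indices vanishes identically (standard; the uniqueness behind
Theorem 2.1's "`m + n - 1` free constants"). -/
theorem recSol_eq_zero_of_window {c : Fin (D + 1) → K} (hc0 : c 0 ≠ 0)
    (hcD : c (Fin.last D) ≠ 0) {u : ℤ → K} (hu : u ∈ recSol c) (s : ℤ)
    (hw : ∀ r : Fin D, u (s + r) = 0) : u = 0 := by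
  -- forward induction: `u` vanishes on `[s, s + D + t)`
  have fwd : ∀ t : ℕ, ∀ j : ℤ, s ≤ j → j < s + D + t → u j = 0 := by
    intro t
    induction t with
    | zero =>
      intro j hj hjt
      have h := hw ⟨(j - s).toNat, by omega⟩
      have e : s + (((j - s).toNat : ℕ) : ℤ) = j := by omega
      rw [← e]
      exact h
    | succ t ih =>
      intro j hj hjt
      by_cases hlt : j < s + D + t
      · exact ih j hj hlt
      have hj' : j = s + t + D := by omega
      have hrel := hu (s + t)
      rw [Fin.sum_univ_castSucc] at hrel
      have hzero : ∑ r : Fin D, c (Fin.castSucc r) * u (s + t + ((Fin.castSucc r : ℕ) : ℤ)) = 0 := by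
        refine Finset.sum_eq_zero fun r _ => ?_
        have h1 := r.isLt
        rw [ih _ (by simp only [Fin.val_castSucc]; omega) (by simp only [Fin.val_castSucc]; omega),
          mul_zero]
      rw [hzero, zero_add, Fin.val_last] at hrel
      rw [hj']
      exact (mul_eq_zero.mp hrel).resolve_left hcD
  -- backward induction: `u` vanishes on `[s - t, s + D)`
  have bwd : ∀ t : ℕ, ∀ j : ℤ, s - t ≤ j → j < s + D → u j = 0 := by
    intro t
    induction t with
    | zero =>
      intro j hj hjt
      exact fwd 0 j (by omega) (by omega)
    | succ t ih =>
      intro j hj hjt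
      by_cases hle : s - t ≤ j
      · exact ih j hle hjt
      have hj' : j = s - t - 1 := by omega
      have hrel := hu (s - t - 1)
      rw [Fin.sum_univ_succ] at hrel
      have hzero : ∑ r : Fin D, c (Fin.succ r) * u (s - t - 1 + ((Fin.succ r : ℕ) : ℤ)) = 0 := by
        refine Finset.sum_eq_zero fun r _ => ?_
        have h1 := r.isLt
        rw [ih _ (by simp only [Fin.val_succ]; push_cast; omega)
          (by simp only [Fin.val_succ]; push_cast; omega), mul_zero]
      rw [hzero, add_zero, Fin.val_zero, Nat.cast_zero, add_zero] at hrel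
      rw [hj']
      exact (mul_eq_zero.mp hrel).resolve_left hc0
  funext j
  rcases lt_or_ge j (s + D) with h | h
  · exact bwd (s - j).toNat j (by omega) h
  · exact fwd ((j - s - D).toNat + 1) j (by omega) (by omega)

/-- [folklore] Restriction of two-sided solutions to the window `[s, s + D)`. -/
def windowMap (c : Fin (D + 1) → K) (s : ℤ) : recSol c →ₗ[K] (Fin D → K) where
  toFun u := fun r => (u : ℤ → K) (s + r)
  map_add' _ _ := rfl
  map_smul' _ _ := rfl

/-- [cite: VysotskyRakhuba2022, Thm. 2.1 (proof)]
The window restriction is injective when the extreme coefficients are nonzero (standard). -/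
theorem windowMap_injective {c : Fin (D + 1) → K} (hc0 : c 0 ≠ 0) (hcD : c (Fin.last D) ≠ 0)
    (s : ℤ) : Function.Injective (windowMap c s) :=
  (injective_iff_map_eq_zero _).2 fun u hu =>
    Subtype.ext (recSol_eq_zero_of_window hc0 hcD u.2 s fun r => congr_fun hu r)

/-- [cite: VysotskyRakhuba2022, Cor. 3.3 (proof)]
The two-sided solution space is finite-dimensional … (standard) -/
theorem finiteDimensional_recSol {c : Fin (D + 1) → K} (hc0 : c 0 ≠ 0)
    (hcD : c (Fin.last D) ≠ 0) : FiniteDimensional K (recSol c) :=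
  FiniteDimensional.of_injective (windowMap c 0) (windowMap_injective hc0 hcD 0)

/-- [cite: VysotskyRakhuba2022, Cor. 3.3 (proof)]
… of dimension at most the order `D` of the recurrence — the count "`1 + ∑_k p_k = 1 + (m+n-1)`"
of the proof of Corollary 3.3, root-free (standard). -/
theorem finrank_recSol_le {c : Fin (D + 1) → K} (hc0 : c 0 ≠ 0) (hcD : c (Fin.last D) ≠ 0) :
    Module.finrank K (recSol c) ≤ D := by
  simpa using LinearMap.finrank_le_finrank_of_injective (windowMap_injective hc0 hcD 0)

/-- [folklore] The one-sided (forward, normalised) recurrence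
`u (i + D) = ∑_{r<D} (-c_r / c_D) u (i + r)` used to build two-sided solutions from a window. -/
private def fwdRec (c : Fin (D + 1) → K) : LinearRecurrence K :=
  ⟨D, fun r => -(c (Fin.castSucc r)) / c (Fin.last D)⟩

/-- [folklore] A solution of the normalised forward recurrence satisfies the original relation
`∑_{r=0}^{D} c_r F(n + r) = 0`. -/
private theorem sum_eq_zero_of_isSolution {c : Fin (D + 1) → K} (hcD : c (Fin.last D) ≠ 0)
    {F : ℕ → K} (hF : (fwdRec c).IsSolution F) (n : ℕ) :
    ∑ r : Fin (D + 1), c r * F (n + r) = 0 := by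
  rw [Fin.sum_univ_castSucc]
  simp only [Fin.val_castSucc, Fin.val_last]
  have h : F (n + D) = ∑ r : Fin D, -(c (Fin.castSucc r)) / c (Fin.last D) * F (n + r) := hF n
  rw [h, Finset.mul_sum, ← Finset.sum_add_distrib]
  refine Finset.sum_eq_zero fun r _ => ?_
  rw [← mul_assoc, mul_div_cancel₀ _ hcD]
  ring

/-- [cite: VysotskyRakhuba2022, Thm. 2.1 (proof)]
Every window of `D` consecutive values extends to a two-sided solution (the extreme coefficients
being nonzero): the existence part of the structure behind Theorem 2.1 (standard; here by gluing
a forward solution with a forward solution of the reversed recurrence). -/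
theorem exists_recSol_window_zero {c : Fin (D + 1) → K} (hc0 : c 0 ≠ 0)
    (hcD : c (Fin.last D) ≠ 0) (w : Fin D → K) :
    ∃ u ∈ recSol c, ∀ r : Fin D, u r = w r := by
  -- forward solution from the window, and forward solution of the reversed recurrence
  have hc0' : (c ∘ Fin.rev) (Fin.last D) ≠ 0 := by simpa [Fin.rev_last] using hc0
  set F : ℕ → K := (fwdRec c).mkSol w with hFdef
  set G : ℕ → K := (fwdRec (c ∘ Fin.rev)).mkSol (fun j => w (Fin.rev j)) with hGdef
  have hFsol : ∀ n : ℕ, ∑ r : Fin (D + 1), c r * F (n + r) = 0 :=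
    sum_eq_zero_of_isSolution hcD ((fwdRec c).is_sol_mkSol w)
  have hGsol : ∀ n : ℕ, ∑ r : Fin (D + 1), c (Fin.rev r) * G (n + r) = 0 :=
    sum_eq_zero_of_isSolution (c := c ∘ Fin.rev) hc0' ((fwdRec (c ∘ Fin.rev)).is_sol_mkSol _)
  have hFinit : ∀ j : Fin D, F j = w j := (fwdRec c).mkSol_eq_init w
  have hGinit : ∀ j : Fin D, G j = w (Fin.rev j) := (fwdRec (c ∘ Fin.rev)).mkSol_eq_init _
  let u : ℤ → K := fun z => if 0 ≤ z then F z.toNat else G ((D : ℤ) - 1 - z).toNat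
  refine ⟨u, ?_, ?_⟩
  · intro i
    rcases le_or_gt 0 i with hi | hi
    · obtain ⟨n, rfl⟩ := Int.eq_ofNat_of_zero_le hi
      have key : ∀ r : Fin (D + 1), u ((n : ℤ) + (r : ℕ)) = F (n + r) := by
        intro r
        simp only [u]
        rw [if_pos (by positivity)]
        exact congrArg F (by omega)
      simp only [key]
      exact hFsol n
    · obtain ⟨n, rfl⟩ : ∃ n : ℕ, i = -(n : ℤ) - 1 := ⟨(-i - 1).toNat, by omega⟩
      have key : ∀ r : Fin (D + 1), u (-(n : ℤ) - 1 + (r : ℕ)) = G (n + D - r) := by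
        intro r
        have hr := r.isLt
        simp only [u]
        by_cases hrn : (r : ℕ) ≤ n
        · rw [if_neg (by omega)]
          congr 1
          omega
        · rw [if_pos (by omega)]
          have h1 : (-(n : ℤ) - 1 + (r : ℕ)).toNat < D := by omega
          have h2 : n + D - r < D := by omega
          rw [show F (-(n : ℤ) - 1 + (r : ℕ)).toNat = w ⟨_, h1⟩ from hFinit ⟨_, h1⟩,
            show G (n + D - r) = w (Fin.rev ⟨_, h2⟩) from hGinit ⟨_, h2⟩]
          congr 1
          ext
          simp only [Fin.val_rev]
          omega
      simp only [key]
      calc ∑ r : Fin (D + 1), c r * G (n + D - r)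
          = ∑ r : Fin (D + 1), c (Fin.rev r) * G (n + r) :=
            Fintype.sum_equiv Fin.revPerm _ _ fun r => by
              simp only [Fin.revPerm_apply, Fin.rev_rev, Fin.val_rev]
              congr 2
              omega
        _ = 0 := hGsol n
  · intro r
    have hr := r.isLt
    simp only [u]
    rw [if_pos (by positivity), show ((r : ℕ) : ℤ).toNat = r from Int.toNat_natCast r]
    exact hFinit r

/-- [cite: VysotskyRakhuba2022, Thm. 2.1 (proof)]
Every window `[s, s + D)` of prescribed values extends to a two-sided solution (standard). -/
theorem exists_recSol_window {c : Fin (D + 1) → K} (hc0 : c 0 ≠ 0) (hcD : c (Fin.last D) ≠ 0)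
    (s : ℤ) (w : Fin D → K) : ∃ u ∈ recSol c, ∀ r : Fin D, u (s + r) = w r := by
  obtain ⟨u, hu, hw⟩ := exists_recSol_window_zero hc0 hcD w
  refine ⟨fun i => u (i + -s), shift_mem_recSol hu (-s), fun r => ?_⟩
  show u (s + r + -s) = w r
  rw [show s + (r : ℤ) + -s = r by ring]
  exact hw r

/-- [cite: VysotskyRakhuba2022, Thm. 2.1 (proof)]
The window restriction is a bijection … (standard) -/
theorem windowMap_surjective {c : Fin (D + 1) → K} (hc0 : c 0 ≠ 0) (hcD : c (Fin.last D) ≠ 0)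
    (s : ℤ) : Function.Surjective (windowMap c s) := by
  intro w
  obtain ⟨u, hu, huw⟩ := exists_recSol_window hc0 hcD s w
  exact ⟨⟨u, hu⟩, funext huw⟩

/-- [cite: VysotskyRakhuba2022, Cor. 3.3 (proof)]
… so the two-sided solution space has dimension exactly `D` (standard; for the band recurrence
`D = m + n - 1`, the number of exponential–polynomial terms `j^p z_k^{-j}`, `j^q w_k^j` in
Theorem 2.1 / Corollary 2.1 and the count used in the proof of Corollary 3.3). -/
theorem finrank_recSol {c : Fin (D + 1) → K} (hc0 : c 0 ≠ 0) (hcD : c (Fin.last D) ≠ 0) :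
    Module.finrank K (recSol c) = D := by
  simpa using (LinearEquiv.ofBijective (windowMap c 0)
    ⟨windowMap_injective hc0 hcD 0, windowMap_surjective hc0 hcD 0⟩).finrank_eq

end TwoSided

/-! ## B. Band circulant matrices, the periodic reading of indices, and Lemma 2.1 -/

section Band

variable {K : Type u} [CommRing K]

/-- The residue of an integer index `z` modulo `N`, as an element of `Fin N` (the periodic
reading `x_i := x_{i mod N}` of [VR2022, Lemma 2.1]).  [cite: VysotskyRakhuba2022, Lemma 2.1] -/
def pmod (N : ℕ) [NeZero N] (z : ℤ) : Fin N :=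
  ⟨(z % (N : ℤ)).toNat, by
    have h0 : (0 : ℤ) < (N : ℤ) := by exact_mod_cast Nat.pos_of_neZero N
    have h1 := Int.emod_nonneg z h0.ne'
    have h2 := Int.emod_lt_of_pos z h0
    omega⟩

section Pmod

variable {N : ℕ} [NeZero N]

/-- [cite: VysotskyRakhuba2022, Lemma 2.1 (proof)]
`pmod N z`, read back in `ℤ`, is `z % N ∈ [0, N)` (index bookkeeping `j mod N`). -/
theorem coe_pmod (z : ℤ) : (((pmod N z : Fin N) : ℕ) : ℤ) = z % (N : ℤ) := by
  have h0 : (0 : ℤ) < (N : ℤ) := by exact_mod_cast Nat.pos_of_neZero N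
  simp only [pmod]
  exact Int.toNat_of_nonneg (Int.emod_nonneg z h0.ne')

/-- [cite: VysotskyRakhuba2022, Lemma 2.1 (proof)]
`pmod N z = y` iff `z ≡ y (mod N)` (index bookkeeping). -/
theorem pmod_eq_iff (z : ℤ) (y : Fin N) : pmod N z = y ↔ (N : ℤ) ∣ z - (y : ℕ) := by
  have h0 : (0 : ℤ) < (N : ℤ) := by exact_mod_cast Nat.pos_of_neZero N
  constructor
  · rintro rfl
    rw [coe_pmod, Int.emod_def, sub_sub_cancel]
    exact dvd_mul_right _ _
  · intro h
    apply Fin.ext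
    have hy := y.isLt
    have e : z % (N : ℤ) = ((y : ℕ) : ℤ) := by
      have h' : ((y : ℕ) : ℤ) % (N : ℤ) = z % (N : ℤ) := Int.modEq_iff_dvd.2 h
      rw [← h', Int.emod_eq_of_lt (by positivity) (by exact_mod_cast hy)]
    have e' := coe_pmod (N := N) z
    rw [e] at e'
    exact_mod_cast e'

/-- [cite: VysotskyRakhuba2022, Lemma 2.1 (proof)]
An index `y ∈ [0, N)` is its own residue (index bookkeeping). -/
@[simp] theorem pmod_natCast (y : Fin N) : pmod N ((y : ℕ) : ℤ) = y :=
  (pmod_eq_iff _ _).2 (by simp)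

/-- [cite: VysotskyRakhuba2022, Lemma 2.1 (proof)]
Two integers have the same residue in `Fin N` iff they are congruent mod `N` (index bookkeeping). -/
theorem pmod_eq_pmod_iff (z z' : ℤ) : pmod N z = pmod N z' ↔ (N : ℤ) ∣ z - z' := by
  rw [pmod_eq_iff, coe_pmod, Int.emod_def,
    show z - (z' - (N : ℤ) * (z' / (N : ℤ))) = z - z' + (N : ℤ) * (z' / (N : ℤ)) by ring,
    dvd_add_left (dvd_mul_right _ _)]

/-- [cite: VysotskyRakhuba2022, Lemma 2.1 (proof)]
For `0 ≤ z < N` the residue is `z` itself (index bookkeeping). -/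
theorem coe_pmod_of_lt {z : ℤ} (h0 : 0 ≤ z) (hz : z < (N : ℤ)) :
    (((pmod N z : Fin N) : ℕ) : ℤ) = z := by
  rw [coe_pmod, Int.emod_eq_of_lt h0 hz]

/-- [cite: VysotskyRakhuba2022, Lemma 2.1 (proof)]
An index in `[0, N)` is divisible by `N` iff it is `0` (`β_j = [j mod N = 0]` read on `[0, N)`
is `e₁`; index bookkeeping). -/
theorem dvd_coe_iff_eq_zero (x : Fin N) : (N : ℤ) ∣ ((x : ℕ) : ℤ) ↔ x = 0 := by
  have h := pmod_eq_iff (N := N) ((x : ℕ) : ℤ) 0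
  rw [pmod_natCast] at h
  simpa using h.symm

end Pmod

/-- [cite: VysotskyRakhuba2022, §2 eq. (2)]
THE BAND CIRCULANT `A = circ(a₀, …, a_{m-1}, 0, …, 0, a_{-n}, …, a_{-1}) ∈ K^{N×N}` with band
coefficients `a_k`, `-n ≤ k ≤ m - 1` (read from `a : ℤ → K` on that range):
`A x y = ∑_{k=-n}^{m-1} [x - y ≡ k (mod N)] a_k`, i.e. `(A u)_x = ∑_k a_k u_{(x-k) mod N}`
(`bandCirc_mulVec`).  For `m + n ≤ N` at most one `k` contributes and this is literally the
matrix (2) of the paper; for smaller `N` the wrapped bands are summed (the periodised stencil). -/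
noncomputable def bandCirc (N m n : ℕ) (a : ℤ → K) : Matrix (Fin N) (Fin N) K :=
  Matrix.of fun x y => ∑ k ∈ Icc (-(n : ℤ)) ((m : ℤ) - 1),
    if (N : ℤ) ∣ ((x : ℕ) : ℤ) - ((y : ℕ) : ℤ) - k then a k else 0

/-- [cite: VysotskyRakhuba2022, §2 eq. (2)]
The first column `(a₀, a₁, …, a_{m-1}, 0, …, 0, a_{-n}, …, a_{-1})ᵀ` of the band circulant:
entry `j` collects the `a_k` with `k ≡ j (mod N)`. -/
noncomputable def bandCol (N m n : ℕ) (a : ℤ → K) : Fin N → K :=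
  fun j => ∑ k ∈ Icc (-(n : ℤ)) ((m : ℤ) - 1), if (N : ℤ) ∣ ((j : ℕ) : ℤ) - k then a k else 0

/-- [folklore] `Fin` subtraction is subtraction modulo `N`. -/
private theorem dvd_coe_sub_sub_iff {N : ℕ} (x y : Fin N) (k : ℤ) :
    (N : ℤ) ∣ (((x - y : Fin N) : ℕ) : ℤ) - k ↔ (N : ℤ) ∣ ((x : ℕ) : ℤ) - ((y : ℕ) : ℤ) - k := by
  have e : (((x : ℕ) : ℤ) - ((y : ℕ) : ℤ)) % (N : ℤ) - k =
      ((x : ℕ) : ℤ) - ((y : ℕ) : ℤ) - k - (N : ℤ) * ((((x : ℕ) : ℤ) - ((y : ℕ) : ℤ)) / (N : ℤ)) := by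
    rw [Int.emod_def]; ring
  rw [Fin.coe_int_sub_eq_mod, e, dvd_sub_left (dvd_mul_right _ _)]

/-- [cite: VysotskyRakhuba2022, §2 eq. (2)]
The band circulant IS the circulant matrix `circ` of its first column
(`Matrix.circulant v i j = v (i - j)`). -/
theorem bandCirc_eq_circulant (N m n : ℕ) (a : ℤ → K) :
    bandCirc N m n a = Matrix.circulant (bandCol N m n a) := by
  ext x y
  simp only [bandCirc, bandCol, Matrix.of_apply, Matrix.circulant_apply]
  exact Finset.sum_congr rfl fun k _ => if_congr (dvd_coe_sub_sub_iff x y k).symm rfl rfl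

/-- [cite: VysotskyRakhuba2022, §2 eq. (2)]
When the band fits (`m + n ≤ N`) the first column is literally
`(a₀, …, a_{m-1}, 0, …, 0, a_{-n}, …, a_{-1})ᵀ`: entry `j` is `a_j` for `j < m`,
`a_{j-N}` for `j ≥ N - n`, and `0` in between. -/
theorem bandCol_apply_of_le {N m n : ℕ} (hN : m + n ≤ N) (a : ℤ → K) (j : Fin N) :
    bandCol N m n a j =
      if (j : ℕ) < m then a j else if N - n ≤ (j : ℕ) then a ((j : ℕ) - (N : ℤ)) else 0 := by
  have hj := j.isLt
  -- a nonzero integer of absolute value `< N` is not a multiple of `N`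
  have hnd : ∀ z : ℤ, -(N : ℤ) < z → z < N → z ≠ 0 → ¬ (N : ℤ) ∣ z := fun z h1 h2 hz hd =>
    hz (Int.eq_zero_of_abs_lt_dvd hd (abs_lt.2 ⟨h1, h2⟩))
  unfold bandCol
  by_cases h1 : (j : ℕ) < m
  · rw [if_pos h1]
    rw [Finset.sum_eq_single_of_mem ((j : ℕ) : ℤ) (by rw [Finset.mem_Icc]; omega)]
    · rw [if_pos (by simp)]
    · intro k hk hkj
      rw [Finset.mem_Icc] at hk
      exact if_neg (hnd _ (by omega) (by omega) (by omega))
  · rw [if_neg h1]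
    by_cases h2 : N - n ≤ (j : ℕ)
    · rw [if_pos h2]
      rw [Finset.sum_eq_single_of_mem (((j : ℕ) : ℤ) - (N : ℤ)) (by rw [Finset.mem_Icc]; omega)]
      · rw [if_pos ⟨1, by ring⟩]
      · intro k hk hkj
        rw [Finset.mem_Icc] at hk
        refine if_neg fun hd => ?_
        have hd' : (N : ℤ) ∣ ((j : ℕ) : ℤ) - k - N := (dvd_sub_right hd).2 dvd_rfl
        exact hnd _ (by omega) (by omega) (by omega) hd'
    · rw [if_neg h2]
      refine Finset.sum_eq_zero fun k hk => ?_
      rw [Finset.mem_Icc] at hk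
      exact if_neg (hnd _ (by omega) (by omega) (by omega))

section BandPeriodic

variable {N : ℕ} [NeZero N] {m n : ℕ}

/-- [cite: VysotskyRakhuba2022, Lemma 2.1]
`(A u)_x = ∑_{k=-n}^{m-1} a_k u_{(x - k) mod N}`: a band circulant acts as the periodised
difference stencil. -/
theorem bandCirc_mulVec (a : ℤ → K) (v : Fin N → K) (x : Fin N) :
    (bandCirc N m n a *ᵥ v) x =
      ∑ k ∈ Icc (-(n : ℤ)) ((m : ℤ) - 1), a k * v (pmod N (((x : ℕ) : ℤ) - k)) := by
  simp only [Matrix.mulVec, dotProduct, bandCirc, Matrix.of_apply, Finset.sum_mul]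
  rw [Finset.sum_comm]
  refine Finset.sum_congr rfl fun k _ => ?_
  have hiff : ∀ y : Fin N,
      ((N : ℤ) ∣ ((x : ℕ) : ℤ) - ((y : ℕ) : ℤ) - k) ↔ pmod N (((x : ℕ) : ℤ) - k) = y := fun y => by
    rw [pmod_eq_iff, sub_right_comm]
  have hterm : ∀ y : Fin N,
      (if (N : ℤ) ∣ ((x : ℕ) : ℤ) - ((y : ℕ) : ℤ) - k then a k else 0) * v y =
        if pmod N (((x : ℕ) : ℤ) - k) = y then a k * v y else 0 := fun y => by
    by_cases hy : pmod N (((x : ℕ) : ℤ) - k) = y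
    · rw [if_pos ((hiff y).2 hy), if_pos hy]
    · rw [if_neg (fun h' => hy ((hiff y).1 h')), if_neg hy, zero_mul]
  rw [Finset.sum_congr rfl fun y _ => hterm y, Finset.sum_ite_eq, if_pos (Finset.mem_univ _)]

/-- [cite: VysotskyRakhuba2022, Lemma 2.1]
LEMMA 2.1: `A u = f` iff the periodically extended vectors (`x_i := x_{i mod N}`) satisfy the
bi-infinite band Toeplitz system `∑_{k=-n}^{m-1} a_k u_{i-k} = f_i` for all `i ∈ ℤ` — here for the
right-hand side `f = e₁` relevant to inversion (`A ξ = e₁ ⇔ A^{(∞)} ξ^{(∞)} = β`,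
`β_i = [N ∣ i]`, eqs. (3)–(4)). -/
theorem bandCirc_mulVec_eq_single_iff (a : ℤ → K) (v : Fin N → K) :
    bandCirc N m n a *ᵥ v = Pi.single 0 1 ↔
      ∀ i : ℤ, ∑ k ∈ Icc (-(n : ℤ)) ((m : ℤ) - 1), a k * v (pmod N (i - k)) =
        if (N : ℤ) ∣ i then 1 else 0 := by
  constructor
  · intro h i
    have hx := congr_fun h (pmod N i)
    rw [bandCirc_mulVec, Pi.single_apply] at hx
    have e1 : ∀ k : ℤ, pmod N ((((pmod N i : Fin N) : ℕ) : ℤ) - k) = pmod N (i - k) := fun k => by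
      rw [pmod_eq_pmod_iff, coe_pmod, show i % (N : ℤ) - k - (i - k) = -(i - i % (N : ℤ)) by ring,
        dvd_neg, Int.emod_def, sub_sub_cancel]
      exact dvd_mul_right _ _
    simp only [e1] at hx
    rw [hx]
    refine if_congr ?_ rfl rfl
    rw [pmod_eq_iff]
    simp
  · intro h
    funext x
    rw [bandCirc_mulVec, Pi.single_apply, h ((x : ℕ) : ℤ)]
    exact if_congr (dvd_coe_iff_eq_zero x) rfl rfl

/-- [cite: VysotskyRakhuba2022, Lemma 2.1]
General right-hand side: `A u = f ⇔ ∑_k a_k u_{(i-k) mod N} = f_{i mod N}` for all `i ∈ ℤ`. -/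
theorem bandCirc_mulVec_eq_iff (a : ℤ → K) (v f : Fin N → K) :
    bandCirc N m n a *ᵥ v = f ↔
      ∀ i : ℤ, ∑ k ∈ Icc (-(n : ℤ)) ((m : ℤ) - 1), a k * v (pmod N (i - k)) = f (pmod N i) := by
  constructor
  · intro h i
    have hx := congr_fun h (pmod N i)
    rw [bandCirc_mulVec] at hx
    have e1 : ∀ k : ℤ, pmod N ((((pmod N i : Fin N) : ℕ) : ℤ) - k) = pmod N (i - k) := fun k => by
      rw [pmod_eq_pmod_iff, coe_pmod, show i % (N : ℤ) - k - (i - k) = -(i - i % (N : ℤ)) by ring,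
        dvd_neg, Int.emod_def, sub_sub_cancel]
      exact dvd_mul_right _ _
    simp only [e1] at hx
    exact hx
  · intro h
    funext x
    rw [bandCirc_mulVec, h ((x : ℕ) : ℤ), pmod_natCast]

/-- [cite: VysotskyRakhuba2022, §2]
"An inverse of a circulant is again a circulant, so it is sufficient to find only the first
column `ξ = A⁻¹ e₁`": if `A ξ = e₁` for a band circulant `A`, then `A⁻¹ = circ(ξ)`. -/
theorem inv_bandCirc_eq_circulant {a : ℤ → K} {v : Fin N → K}
    (hv : bandCirc N m n a *ᵥ v = Pi.single 0 1) : (bandCirc N m n a)⁻¹ = Matrix.circulant v := by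
  apply Matrix.inv_eq_right_inv
  rw [bandCirc_eq_circulant, Matrix.circulant_mul, ← bandCirc_eq_circulant, hv,
    Matrix.circulant_single_one]

/-- [cite: VysotskyRakhuba2022, §2]
For an invertible band circulant the first column `ξ_j = (A⁻¹)_{j,0}` of the inverse solves
`A ξ = e₁`. -/
theorem bandCirc_mulVec_invCol {a : ℤ → K} (hA : IsUnit (bandCirc N m n a).det) :
    bandCirc N m n a *ᵥ (fun j => (bandCirc N m n a)⁻¹ j 0) = Pi.single 0 1 := by
  funext i
  have h := congr_fun (congr_fun (Matrix.mul_nonsing_inv _ hA) i) 0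
  rw [Matrix.mul_apply, Matrix.one_apply] at h
  rw [Pi.single_apply]
  exact h

end BandPeriodic

end Band

/-! ## C. The recurrence of the band and the structure of `A⁻¹` (Theorem 2.1) -/

section Structure

variable {K : Type u}

/-- [cite: VysotskyRakhuba2022, Thm. 2.1 (proof)]
The coefficients of the order-`(m+n-1)` recurrence carried by the band, listed from the top of
the band: `c_r = a_{m-1-r}`, `r = 0, …, m+n-1` — so that `∑_k a_k u_{i-k} = ∑_r c_r u_{i-(m-1)+r}`;
its characteristic polynomial is `h(z) = ∑_k a_k z^{m-1-k}` of Lemma 2.2 / Theorem 2.1. -/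
def bandCoeff (m n : ℕ) (a : ℤ → K) : Fin (m + n - 1 + 1) → K :=
  fun r => a ((m : ℤ) - 1 - (r : ℕ))

/-- [folklore] Reindexing the band `k = m - 1 - r`. -/
private theorem sum_Icc_eq_sum_fin {M : Type*} [AddCommMonoid M] (m n : ℕ) (hmn : 1 ≤ m + n)
    (φ : ℤ → M) :
    ∑ k ∈ Icc (-(n : ℤ)) ((m : ℤ) - 1), φ k = ∑ r : Fin (m + n - 1 + 1), φ ((m : ℤ) - 1 - (r : ℕ)) := by
  refine Finset.sum_bij' (fun k hk => ⟨((m : ℤ) - 1 - k).toNat, ?_⟩)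
    (fun r _ => (m : ℤ) - 1 - (r : ℕ)) ?_ ?_ ?_ ?_ ?_
  · rw [Finset.mem_Icc] at hk; omega
  · intro k hk; exact Finset.mem_univ _
  · intro r _; have := r.isLt; rw [Finset.mem_Icc]; omega
  · intro k hk; rw [Finset.mem_Icc] at hk; simp only; omega
  · intro r _; have := r.isLt; ext; simp only; omega
  · intro k hk; rw [Finset.mem_Icc] at hk; simp only; congr 1; omega

/-- [cite: VysotskyRakhuba2022, Thm. 2.1 (proof)] The leading coefficient is `a_{m-1}`. -/
theorem bandCoeff_zero (m n : ℕ) (a : ℤ → K) : bandCoeff m n a 0 = a ((m : ℤ) - 1) := by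
  simp [bandCoeff]

/-- [cite: VysotskyRakhuba2022, Thm. 2.1 (proof)] The trailing coefficient is `a_{-n}`. -/
theorem bandCoeff_last (m n : ℕ) (hmn : 1 ≤ m + n) (a : ℤ → K) :
    bandCoeff m n a (Fin.last (m + n - 1)) = a (-(n : ℤ)) := by
  simp only [bandCoeff, Fin.val_last]
  exact congrArg a (by omega)

variable [Field K]

/-- [cite: VysotskyRakhuba2022, §2 eq. (4)]
A two-sided sequence solves the homogeneous band system `∑_{k=-n}^{m-1} a_k u_{i-k} = 0`
(all `i ∈ ℤ`) iff it lies in the solution space `recSol (bandCoeff m n a)` of the band's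
recurrence. -/
theorem mem_recSol_bandCoeff_iff {m n : ℕ} (hmn : 1 ≤ m + n) (a : ℤ → K) (u : ℤ → K) :
    u ∈ recSol (bandCoeff m n a) ↔
      ∀ i : ℤ, ∑ k ∈ Icc (-(n : ℤ)) ((m : ℤ) - 1), a k * u (i - k) = 0 := by
  rw [mem_recSol_iff]
  constructor
  · intro h i
    rw [sum_Icc_eq_sum_fin m n hmn]
    have h' := h (i - ((m : ℤ) - 1))
    refine Eq.trans (Finset.sum_congr rfl fun r _ => ?_) h'
    have e : i - ((m : ℤ) - 1 - ((r : ℕ) : ℤ)) = i - ((m : ℤ) - 1) + ((r : ℕ) : ℤ) := by ring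
    simp only [bandCoeff, e]
  · intro h i
    have h' := h (i + ((m : ℤ) - 1))
    rw [sum_Icc_eq_sum_fin m n hmn] at h'
    refine Eq.trans (Finset.sum_congr rfl fun r _ => ?_) h'
    have e : i + ((r : ℕ) : ℤ) = i + ((m : ℤ) - 1) - ((m : ℤ) - 1 - ((r : ℕ) : ℤ)) := by ring
    simp only [bandCoeff, e]

/-- [folklore] Uniqueness along a stencil: two sequences that agree on `[0, D)` and both satisfy
the order-`D` relation `∑_r c_r u_{j-D+r} = 0` for `D ≤ j < N` (leading coefficient `c_D ≠ 0`)
agree on `[0, N)`. -/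
private theorem eqOn_of_stencil {D : ℕ} {c : Fin (D + 1) → K} (hcD : c (Fin.last D) ≠ 0)
    {E V : ℤ → K} {N : ℤ}
    (hE : ∀ j : ℤ, (D : ℤ) ≤ j → j < N → ∑ r : Fin (D + 1), c r * E (j - D + (r : ℕ)) = 0)
    (hV : ∀ j : ℤ, (D : ℤ) ≤ j → j < N → ∑ r : Fin (D + 1), c r * V (j - D + (r : ℕ)) = 0)
    (h0 : ∀ j : ℤ, 0 ≤ j → j < D → E j = V j) :
    ∀ j : ℤ, 0 ≤ j → j < N → E j = V j := by
  have key : ∀ t : ℕ, ∀ j : ℤ, 0 ≤ j → j < N → j < t → E j = V j := by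
    intro t
    induction t with
    | zero => intro j hj _ hjt; omega
    | succ t ih =>
      intro j hj hjN hjt
      by_cases hlt : j < t
      · exact ih j hj hjN hlt
      by_cases hjD : j < D
      · exact h0 j hj hjD
      have hEj := hE j (by omega) hjN
      have hVj := hV j (by omega) hjN
      rw [Fin.sum_univ_castSucc] at hEj hVj
      simp only [Fin.val_castSucc, Fin.val_last] at hEj hVj
      have hlow : ∑ r : Fin D, c (Fin.castSucc r) * E (j - D + (r : ℕ)) =
          ∑ r : Fin D, c (Fin.castSucc r) * V (j - D + (r : ℕ)) := by
        refine Finset.sum_congr rfl fun r _ => ?_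
        have hr := r.isLt
        rw [ih (j - D + (r : ℕ)) (by omega) (by omega) (by omega)]
      have hjj : j - (D : ℤ) + ((D : ℕ) : ℤ) = j := by omega
      rw [hjj] at hEj hVj
      rw [hlow] at hEj
      have : c (Fin.last D) * E j = c (Fin.last D) * V j := by
        rw [← sub_eq_zero]
        have := sub_eq_zero.2 (hEj.trans hVj.symm)
        rw [← this]
        ring
      exact mul_left_cancel₀ hcD this
  intro j hj hjN
  exact key (j.toNat + 1) j hj hjN (by omega)

variable {N : ℕ} [NeZero N] {m n : ℕ}

/-- [cite: VysotskyRakhuba2022, Thm. 2.1]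
THEOREM 2.1 (structural form, over any field, for any invertible band circulant with `m ≥ 2`,
`a_{m-1} ≠ 0 ≠ a_{-n}`): the solution `ξ` of `A ξ = e₁` — the first column of `A⁻¹` — is the
restriction to `j = 0, …, N-1` of a TWO-SIDED solution `E` of the band's homogeneous recurrence
`∑_{k=-n}^{m-1} a_k E_{i-k} = 0` (`i ∈ ℤ`), whose solution space has dimension `m + n - 1`
(`finrank_recSol`).  The paper's formula (7) writes such an `E` in the basis `j^p z_k^{-j}` of
that space (roots `z_k` of `f(z) = ∑_k a_k z^k`); here only the membership is asserted. -/
theorem exists_recSol_eq_of_mulVec_eq_single (hm : 2 ≤ m) {a : ℤ → K}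
    (htop : a ((m : ℤ) - 1) ≠ 0) (hbot : a (-(n : ℤ)) ≠ 0) {v : Fin N → K}
    (hv : bandCirc N m n a *ᵥ v = Pi.single 0 1) :
    ∃ E ∈ recSol (bandCoeff m n a), ∀ j : Fin N, E ((j : ℕ) : ℤ) = v j := by
  have hmn : 1 ≤ m + n := by omega
  have hc0 : bandCoeff m n a 0 ≠ 0 := by rwa [bandCoeff_zero]
  have hcD : bandCoeff m n a (Fin.last (m + n - 1)) ≠ 0 := by rwa [bandCoeff_last m n hmn]
  -- the periodic extension `V i = v (i mod N)` and a two-sided solution with the same window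
  set V : ℤ → K := fun i => v (pmod N i) with hVdef
  obtain ⟨E, hE, hEw⟩ :=
    exists_recSol_window_zero hc0 hcD (fun r : Fin (m + n - 1) => V ((r : ℕ) : ℤ))
  refine ⟨E, hE, ?_⟩
  -- the band system (Lemma 2.1) along the stencils that stay inside `[0, N)`
  have hsys := (bandCirc_mulVec_eq_single_iff a v).1 hv
  have hVst : ∀ j : ℤ, ((m + n - 1 : ℕ) : ℤ) ≤ j → j < (N : ℤ) →
      ∑ r : Fin (m + n - 1 + 1), bandCoeff m n a r * V (j - (m + n - 1 : ℕ) + (r : ℕ)) = 0 := by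
    intro j hj hjN
    have h1 := hsys (j - n)
    rw [if_neg, sum_Icc_eq_sum_fin m n hmn] at h1
    · refine Eq.trans (Finset.sum_congr rfl fun r _ => ?_) h1
      have e : j - ((m + n - 1 : ℕ) : ℤ) + ((r : ℕ) : ℤ) =
          j - (n : ℤ) - ((m : ℤ) - 1 - ((r : ℕ) : ℤ)) := by omega
      simp only [bandCoeff, hVdef, e]
    · intro hd
      have := Int.le_of_dvd (by omega) hd
      omega
  have hEst : ∀ j : ℤ, ((m + n - 1 : ℕ) : ℤ) ≤ j → j < (N : ℤ) →
      ∑ r : Fin (m + n - 1 + 1), bandCoeff m n a r * E (j - (m + n - 1 : ℕ) + (r : ℕ)) = 0 :=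
    fun j _ _ => hE (j - (m + n - 1 : ℕ))
  have hwin : ∀ j : ℤ, 0 ≤ j → j < ((m + n - 1 : ℕ) : ℤ) → E j = V j := by
    intro j hj hjD
    have h := hEw ⟨j.toNat, by omega⟩
    have e : ((j.toNat : ℕ) : ℤ) = j := by omega
    simp only [e] at h
    exact h
  have hEV := eqOn_of_stencil (c := bandCoeff m n a) hcD hEst hVst hwin
  intro j
  rw [hEV ((j : ℕ) : ℤ) (by positivity) (by exact_mod_cast j.isLt), hVdef]
  simp only [pmod_natCast]

/-- [cite: VysotskyRakhuba2022, Thm. 2.1]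
THEOREM 2.1, consequence for the inverse: `A⁻¹ = circ(E|_{[0,N)})` for a two-sided solution `E`
of the band recurrence (any field; `A` invertible, `m ≥ 2`, `a_{m-1} ≠ 0 ≠ a_{-n}`). -/
theorem exists_recSol_inv_bandCirc_eq_circulant (hm : 2 ≤ m) {a : ℤ → K}
    (htop : a ((m : ℤ) - 1) ≠ 0) (hbot : a (-(n : ℤ)) ≠ 0)
    (hA : IsUnit (bandCirc N m n a).det) :
    ∃ E ∈ recSol (bandCoeff m n a),
      (bandCirc N m n a)⁻¹ = Matrix.circulant fun j : Fin N => E ((j : ℕ) : ℤ) := by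
  obtain ⟨E, hE, hEv⟩ :=
    exists_recSol_eq_of_mulVec_eq_single hm htop hbot (bandCirc_mulVec_invCol hA)
  refine ⟨E, hE, ?_⟩
  rw [inv_bandCirc_eq_circulant (bandCirc_mulVec_invCol hA)]
  congr 1
  funext j
  exact (hEv j).symm

/-- [cite: VysotskyRakhuba2022, §2 eq. (5)]
THE SYMBOL of the band circulant: the Laurent polynomial
`f(z) = a_{-n} z^{-n} + ⋯ + a_{-1} z^{-1} + a₀ + a₁ z + ⋯ + a_{m-1} z^{m-1}`, as a function
(`z ^ k` an integer power). -/
noncomputable def symbol (m n : ℕ) (a : ℤ → K) (z : K) : K :=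
  ∑ k ∈ Icc (-(n : ℤ)) ((m : ℤ) - 1), a k * z ^ k

/-- [cite: VysotskyRakhuba2022, Thm. 2.1]
`g(z) = ∑_{k=-n}^{m-1} a_k z^{k+n}` (`= z^n f(z)`, `eval_gPoly`). -/
noncomputable def gPoly (m n : ℕ) (a : ℤ → K) : Polynomial K :=
  ∑ k ∈ Icc (-(n : ℤ)) ((m : ℤ) - 1), Polynomial.C (a k) * Polynomial.X ^ (k + n).toNat

/-- [cite: VysotskyRakhuba2022, Thm. 2.1]
`h(z) = ∑_{k=-n}^{m-1} a_k z^{m-k-1}` (`= z^{m-1} f(1/z)`, `eval_hPoly`; Lemma 2.2's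
`1/f(z⁻¹) = z^{m-1}/h(z)`): the characteristic polynomial of the band recurrence
(`hPoly_eq_sum_bandCoeff`). -/
noncomputable def hPoly (m n : ℕ) (a : ℤ → K) : Polynomial K :=
  ∑ k ∈ Icc (-(n : ℤ)) ((m : ℤ) - 1), Polynomial.C (a k) * Polynomial.X ^ ((m : ℤ) - k - 1).toNat

/-- [cite: VysotskyRakhuba2022, Thm. 2.1] `g(z) = z^n f(z)` for `z ≠ 0`. -/
theorem eval_gPoly {m n : ℕ} (a : ℤ → K) {z : K} (hz : z ≠ 0) :
    (gPoly m n a).eval z = z ^ n * symbol m n a z := by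
  simp only [gPoly, symbol, Polynomial.eval_finsetSum, Polynomial.eval_mul, Polynomial.eval_C,
    Polynomial.eval_pow, Polynomial.eval_X, Finset.mul_sum]
  refine Finset.sum_congr rfl fun k hk => ?_
  rw [Finset.mem_Icc] at hk
  rw [← zpow_natCast, Int.toNat_of_nonneg (by omega), zpow_add₀ hz, zpow_natCast]
  ring

/-- [cite: VysotskyRakhuba2022, Thm. 2.1] `h(z) = z^{m-1} f(1/z)` for `z ≠ 0` (`m ≥ 1`). -/
theorem eval_hPoly {m n : ℕ} (hm : 1 ≤ m) (a : ℤ → K) {z : K} (hz : z ≠ 0) :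
    (hPoly m n a).eval z = z ^ (m - 1) * symbol m n a z⁻¹ := by
  simp only [hPoly, symbol, Polynomial.eval_finsetSum, Polynomial.eval_mul, Polynomial.eval_C,
    Polynomial.eval_pow, Polynomial.eval_X, Finset.mul_sum]
  refine Finset.sum_congr rfl fun k hk => ?_
  rw [Finset.mem_Icc] at hk
  rw [← zpow_natCast z ((m : ℤ) - k - 1).toNat, Int.toNat_of_nonneg (by omega),
    _root_.inv_zpow', ← zpow_natCast z (m - 1), Nat.cast_sub hm, Nat.cast_one,
    show (m : ℤ) - k - 1 = ((m : ℤ) - 1) + (-k) by ring, zpow_add₀ hz]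
  ring

/-- [cite: VysotskyRakhuba2022, Thm. 2.1 (proof)]
`h` is the characteristic polynomial `∑_r c_r z^r` of the band recurrence (`c_r = a_{m-1-r}`). -/
theorem hPoly_eq_sum_bandCoeff {m n : ℕ} (hmn : 1 ≤ m + n) (a : ℤ → K) :
    hPoly m n a = ∑ r : Fin (m + n - 1 + 1),
      Polynomial.C (bandCoeff m n a r) * Polynomial.X ^ (r : ℕ) := by
  unfold hPoly
  rw [sum_Icc_eq_sum_fin m n hmn]
  refine Finset.sum_congr rfl fun r _ => ?_
  simp only [bandCoeff]
  congr 2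
  omega

/-- [cite: VysotskyRakhuba2022, Thm. 2.1 (eq. (7))]
Geometric two-sided sequences `w^i` (`w ≠ 0`) solve the band recurrence iff `h(w) = 0`, i.e. iff
`f(1/w) = 0` — the exponentials `w_k^{j}` and `z_k^{-j}` (roots `w_k` of `h`, `z_k` of `g`) of
formula (7). -/
theorem zpow_mem_recSol_bandCoeff_iff {m n : ℕ} (hmn : 1 ≤ m + n) {a : ℤ → K} {w : K}
    (hw : w ≠ 0) : (fun i : ℤ => w ^ i) ∈ recSol (bandCoeff m n a) ↔ (hPoly m n a).eval w = 0 := by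
  have hev : (hPoly m n a).eval w =
      ∑ r : Fin (m + n - 1 + 1), bandCoeff m n a r * w ^ (r : ℕ) := by
    simp only [hPoly_eq_sum_bandCoeff hmn, Polynomial.eval_finsetSum, Polynomial.eval_mul,
      Polynomial.eval_C, Polynomial.eval_pow, Polynomial.eval_X]
  have hfac : ∀ i : ℤ, ∑ r : Fin (m + n - 1 + 1), bandCoeff m n a r * w ^ (i + (r : ℕ)) =
      w ^ i * (hPoly m n a).eval w := by
    intro i
    rw [hev, Finset.mul_sum]
    refine Finset.sum_congr rfl fun r _ => ?_
    rw [zpow_add₀ hw, zpow_natCast]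
    ring
  rw [mem_recSol_iff]
  constructor
  · intro h
    have h0 := h 0
    rw [hfac, zpow_zero, one_mul] at h0
    exact h0
  · intro h i
    rw [hfac, h, mul_zero]

/-- [cite: VysotskyRakhuba2022, Thm. 2.1 (eq. (7))]
Equivalently (`w ≠ 0`): `w^i` solves the band recurrence iff `f(1/w) = 0`; with `w = 1/z_k` these
are the terms `z_k^{-j}` of formula (7). -/
theorem zpow_mem_recSol_bandCoeff_iff_symbol {m n : ℕ} (hm : 1 ≤ m) {a : ℤ → K} {w : K}
    (hw : w ≠ 0) : (fun i : ℤ => w ^ i) ∈ recSol (bandCoeff m n a) ↔ symbol m n a w⁻¹ = 0 := by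
  rw [zpow_mem_recSol_bandCoeff_iff (by omega) hw, eval_hPoly hm a hw, mul_eq_zero,
    or_iff_right (pow_ne_zero _ hw)]

end Structure

/-! ## C'. Proposition 2.1: invertibility over `ℂ` via the DFT eigenvalues -/

section ComplexInvertibility

open Literature.LinearAlgebra.Matrix Literature.Combinatorics.SimpleGraph

variable {N : ℕ} [NeZero N] {m n : ℕ}

/-- [cite: VysotskyRakhuba2022, Prop. 2.1 (proof)]
"The eigenvalues `λ_s` of `A` are the elements of column `F_N A_{:,0}` …
`λ_s = ∑_t e^{-2πi st/N} A_{t,0} = f(e^{-2πi s/N})`": the DFT eigenvalue of the band circulant on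
mode `s` is the symbol at `ζ_s⁻¹ = e^{-2πi s/N}`. -/
theorem circulantEig_bandCol (a : ℤ → ℂ) (s : Fin N) :
    circulantEig (bandCol N m n a) s = symbol m n a (cycleRoot N s)⁻¹ := by
  have hζ : cycleRoot N s ≠ 0 := cycleRoot_ne_zero s
  simp only [circulantEig, bandCol, symbol, Finset.sum_mul]
  rw [Finset.sum_comm]
  refine Finset.sum_congr rfl fun k _ => ?_
  have hiff : ∀ t : Fin N, (N : ℤ) ∣ ((t : ℕ) : ℤ) - k ↔ pmod N k = t := fun t => by
    rw [pmod_eq_iff, dvd_sub_comm]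
  have hterm : ∀ t : Fin N,
      (if (N : ℤ) ∣ ((t : ℕ) : ℤ) - k then a k else 0) * (cycleRoot N s ^ (t : ℕ))⁻¹ =
        if pmod N k = t then a k * (cycleRoot N s ^ (t : ℕ))⁻¹ else 0 := fun t => by
    by_cases ht : pmod N k = t
    · rw [if_pos ((hiff t).2 ht), if_pos ht]
    · rw [if_neg (fun h' => ht ((hiff t).1 h')), if_neg ht, zero_mul]
  rw [Finset.sum_congr rfl fun t _ => hterm t, Finset.sum_ite_eq, if_pos (Finset.mem_univ _)]
  congr 1
  -- `ζ_s^{k mod N} = ζ_s^k` since `ζ_s^N = 1`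
  rw [_root_.inv_zpow, ← zpow_natCast, coe_pmod]
  congr 1
  conv_rhs => rw [← Int.emod_add_mul_ediv k (N : ℤ)]
  rw [zpow_add₀ hζ, _root_.zpow_mul, zpow_natCast, cycleRoot_pow_card, _root_.one_zpow, mul_one]

/-- [cite: VysotskyRakhuba2022, Prop. 2.1]
PROPOSITION 2.1 (symbol form): the band circulant `A ∈ ℂ^{N×N}` is invertible iff
`f(e^{-2πi s/N}) ≠ 0` for all `s = 0, …, N-1`. -/
theorem isUnit_det_bandCirc_iff_symbol (a : ℤ → ℂ) :
    IsUnit (bandCirc N m n a).det ↔ ∀ s : Fin N, symbol m n a (cycleRoot N s)⁻¹ ≠ 0 := by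
  rw [isUnit_iff_ne_zero, bandCirc_eq_circulant, det_circulant_eq_prod_circulantEig,
    Finset.prod_ne_zero_iff]
  simp only [Finset.mem_univ, true_implies, circulantEig_bandCol]

/-- [cite: VysotskyRakhuba2022, Prop. 2.1]
PROPOSITION 2.1 (as printed): "The circulant `A ∈ ℂ^{N×N}` is invertible if and only if the
corresponding polynomial `g(z)` does not have roots of the form `e^{-2πi s/N}`,
`s ∈ {0, …, N-1}`." -/
theorem isUnit_det_bandCirc_iff_gPoly (a : ℤ → ℂ) :
    IsUnit (bandCirc N m n a).det ↔ ∀ s : Fin N, (gPoly m n a).eval (cycleRoot N s)⁻¹ ≠ 0 := by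
  rw [isUnit_det_bandCirc_iff_symbol]
  refine forall_congr' fun s => ?_
  have hζ : (cycleRoot N s)⁻¹ ≠ 0 := inv_ne_zero (cycleRoot_ne_zero s)
  rw [eval_gPoly a hζ, mul_ne_zero_iff, and_iff_right (pow_ne_zero _ hζ)]

end ComplexInvertibility

/-! ## D. Corollary 3.3: QTT ranks of the inverse -/

section QTTInverse

variable {K : Type u} [Field K] {b : ℕ} [NeZero b] {L m n : ℕ}

/-- [cite: VysotskyRakhuba2022, Cor. 3.3]
COROLLARY 3.3 (rank form, over any field): for an invertible `b^L × b^L` band circulant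
`A = circ(a₀, …, a_{m-1}, 0, …, 0, a_{-n}, …, a_{-1})` with `m ≥ 2` and `a_{m-1} ≠ 0 ≠ a_{-n}`,
every QTT unfolding matrix of `A⁻¹` has rank at most `m + n`.  (Proof as in the paper:
`A⁻¹ = circ(E)` for a two-sided solution `E` of the band recurrence — Theorem 2.1 — whose shifts
span a space of dimension `≤ m + n - 1`, and Theorem 3.1 / Corollary 3.1.) -/
theorem rank_qttUnfolding_inv_bandCirc_le (hm : 2 ≤ m) (a : ℤ → K)
    (htop : a ((m : ℤ) - 1) ≠ 0) (hbot : a (-(n : ℤ)) ≠ 0)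
    (hA : IsUnit (bandCirc (b ^ L) m n a).det) (k l : ℕ) (h : k + l = L) :
    (qttUnfolding (bandCirc (b ^ L) m n a)⁻¹ k l h).rank ≤ m + n := by
  haveI : NeZero (b ^ L) := ⟨pow_ne_zero _ (NeZero.ne b)⟩
  have hmn : 1 ≤ m + n := by omega
  have hc0 : bandCoeff m n a 0 ≠ 0 := by rwa [bandCoeff_zero]
  have hcD : bandCoeff m n a (Fin.last (m + n - 1)) ≠ 0 := by rwa [bandCoeff_last m n hmn]
  haveI := finiteDimensional_recSol hc0 hcD
  obtain ⟨E, hE, hinv⟩ := exists_recSol_inv_bandCirc_eq_circulant (N := b ^ L) hm htop hbot hA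
  rw [hinv]
  calc (qttUnfolding (Matrix.circulant fun j : Fin (b ^ L) => E ((j : ℕ) : ℤ)) k l h).rank
      ≤ 1 + Module.finrank K (recSol (bandCoeff m n a)) :=
        rank_qttUnfolding_circulant_le E (recSol (bandCoeff m n a))
          (fun q => shift_mem_recSol hE q) b k l h
    _ ≤ 1 + (m + n - 1) := by
        have := finrank_recSol_le hc0 hcD
        omega
    _ = m + n := by omega

/-- [cite: VysotskyRakhuba2022, Cor. 3.3]
COROLLARY 3.3 (representation form, over `ℝ`): under the same hypotheses `A⁻¹` admits a QTT
representation ("the QTT ranks of `A⁻¹` do not exceed `m + n`"; boundary ranks `1`). -/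
theorem exists_qttMatrix_eq_inv_bandCirc (hm : 2 ≤ m) (a : ℤ → ℝ)
    (htop : a ((m : ℤ) - 1) ≠ 0) (hbot : a (-(n : ℤ)) ≠ 0)
    (hA : IsUnit (bandCirc (b ^ L) m n a).det) :
    ∃ T : TensorTrain ℝ (Fin b × Fin b) L,
      T.qttMatrix = (bandCirc (b ^ L) m n a)⁻¹ ∧ T.r 0 = 1 ∧ (0 < L → T.r L = 1) ∧
        ∀ k, 0 < k → k < L → T.r k ≤ m + n := by
  haveI : NeZero (b ^ L) := ⟨pow_ne_zero _ (NeZero.ne b)⟩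
  have hmn : 1 ≤ m + n := by omega
  have hc0 : bandCoeff m n a 0 ≠ 0 := by rwa [bandCoeff_zero]
  have hcD : bandCoeff m n a (Fin.last (m + n - 1)) ≠ 0 := by rwa [bandCoeff_last m n hmn]
  haveI := finiteDimensional_recSol hc0 hcD
  obtain ⟨E, hE, hinv⟩ := exists_recSol_inv_bandCirc_eq_circulant (N := b ^ L) hm htop hbot hA
  obtain ⟨T, hT, h0, hL, hr⟩ := exists_qttMatrix_eq_circulant_rank_le E (recSol (bandCoeff m n a))
    (fun q => shift_mem_recSol hE q) b L
  refine ⟨T, hT.trans hinv.symm, h0, hL, fun k hk hkL => (hr k hk hkL).trans ?_⟩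
  have := finrank_recSol_le hc0 hcD
  omega

end QTTInverse

end Literature.LinearAlgebra.TensorNetworks.BandCirculant
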